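import Summits.Ventures.Crystal3D.Theorems.StickyWulffConstantTextureLiminfCellFlux
import HarnessLib

/-!
# The wall cell inequality is ANTITONE in the charge table (so the maximal admissible table is the only one to prove)
# (lane T, crux `TextureLiminf`, stmt-Ventures-19483; bookkeeping for TexShadow v6.12's parts)

HONEST FRAMING. Venture `Summits/Ventures/Crystal3D` (cell `crystal3d-full`), helper `--supports` the crux
`TextureLiminf` (stmt-Ventures-19483) of `route-Ventures-StickyWulffConstant`, registered line `TexShadow`.  Rung credit
only; F-C1 not moved.  Pure bookkeeping; NOT the wall law.

`BilayerWallAt C R₀ σ₁ σ₂ L₁ L₂ s₁ s₂ c` subtracts the charge `Q(c) = Σ' c i j · |slice ∩ slab₁ i ∩ slab₂ j|`; a larger table is a stronger claim.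
* **`bilayerWallAt_anti_table`** — `0 ≤ c ≤ c' ≤ B` pointwise and the cell inequality for `c'` give it for `c` (`R₀ ≥ 0`).
* `bilayerWallAt_of_const_table` — in particular the CONSTANT table `c' ≡ B` (the law's maximal charge for the pair: `1`, or `½ sin∠(e₃, m)`)
  implies every admissible table below it: per plate pair only ONE table needs a proof (used by the v6.12 parts, whose hypotheses quantify over
  all admissible tables, and by census read-outs, which measure the maximal table).
WHAT THIS IS NOT: no wall law; F-C1 not moved.
-/

noncomputable section

namespace Summit.Ventures.Crystal3D.Theorems

open MeasureTheory Set
open scoped ENNReal InnerProductSpace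
open Literature.MathematicalPhysics.StatisticalMechanics (IsHaggSeq)
open Summit.Ventures.Crystal3D.Cruxes.TextureLiminf.TexShadow (E3 e₃ cyl stacking laySlab BilayerWallAt)

/-- **The cell inequality is antitone in the table.** -/
theorem bilayerWallAt_anti_table {C R₀ : ℝ} (hR₀ : 0 ≤ R₀) {σ₁ σ₂ : ℤ → ℤ} {L₁ L₂ : E3 ≃ₗᵢ[ℝ] E3} {s₁ s₂ : E3}
    {c c' : ℤ → ℤ → ℝ} (B : ℝ) (hc0 : ∀ i j, 0 ≤ c i j) (hcc' : ∀ i j, c i j ≤ c' i j) (hcB : ∀ i j, c' i j ≤ B)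
    (h : BilayerWallAt C R₀ σ₁ σ₂ L₁ L₂ s₁ s₂ c') : BilayerWallAt C R₀ σ₁ σ₂ L₁ L₂ s₁ s₂ c := by
  intro hh hh0 ρ hρ X P₁ P₂ hX hP₁ hP₂ hcyl hP₁def hP₂def
  have key := h hh hh0 ρ hρ X P₁ P₂ hX hP₁ hP₂ hcyl hP₁def hP₂def
  have hρ0 : 0 ≤ ρ := le_trans hR₀ hρ
  have hset : ({q : E3 | 0 ≤ q 2 ∧ q 2 ≤ 1 ∧ q 0 ^ 2 + q 1 ^ 2 ≤ ρ ^ 2} : Set E3) = wallSlice ρ := rfl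
  rw [hset] at key ⊢
  have hSfin : volume (wallSlice ρ) ≠ ⊤ := by rw [volume_wallSlice ρ hρ0]; exact ENNReal.ofReal_ne_top
  have hc'0 : ∀ i j, 0 ≤ c' i j := fun i j => (hc0 i j).trans (hcc' i j)
  have hs := summable_charge L₁ L₂ s₁ s₂ c B hc0 (fun i j => (hcc' i j).trans (hcB i j)) (wallSlice ρ)
    (measurableSet_wallSlice ρ) hSfin
  have hs' := summable_charge L₁ L₂ s₁ s₂ c' B hc'0 hcB (wallSlice ρ) (measurableSet_wallSlice ρ) hSfin
  have hQ : ∑' ij : ℤ × ℤ, c ij.1 ij.2 * (volume (wallSlice ρ ∩ laySlab L₁ s₁ ij.1 ∩ laySlab L₂ s₂ ij.2)).toReal ≤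
      ∑' ij : ℤ × ℤ, c' ij.1 ij.2 * (volume (wallSlice ρ ∩ laySlab L₁ s₁ ij.1 ∩ laySlab L₂ s₂ ij.2)).toReal :=
    Summable.tsum_le_tsum (fun ij => mul_le_mul_of_nonneg_right (hcc' _ _) ENNReal.toReal_nonneg) hs hs'
  linarith

/-- **The constant maximal table suffices**: the cell inequality for `c' ≡ B` implies it for every table `0 ≤ c ≤ B`. -/
theorem bilayerWallAt_of_const_table {C R₀ : ℝ} (hR₀ : 0 ≤ R₀) {σ₁ σ₂ : ℤ → ℤ} {L₁ L₂ : E3 ≃ₗᵢ[ℝ] E3} {s₁ s₂ : E3}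
    (B : ℝ) (h : BilayerWallAt C R₀ σ₁ σ₂ L₁ L₂ s₁ s₂ (fun _ _ => B)) {c : ℤ → ℤ → ℝ} (hc0 : ∀ i j, 0 ≤ c i j)
    (hcB : ∀ i j, c i j ≤ B) : BilayerWallAt C R₀ σ₁ σ₂ L₁ L₂ s₁ s₂ c :=
  bilayerWallAt_anti_table hR₀ B hc0 hcB (fun _ _ => le_rfl) h

end Summit.Ventures.Crystal3D.Theorems

end
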